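import Literature.NumberTheory.LFunctions.KMVHeckeRecursionExactAFE
import Literature.Analysis.SpecialFunctions.MellinIteratedDeriv
import Mathlib.Analysis.SpecialFunctions.Gamma.Deriv
import Mathlib.Analysis.MellinTransform
import HarnessLib

/-!
# KMV 2000 (13)/(22): the derivative kernel `D_i(q̂; n, t) = ∂ᵢ/∂tⁱ [q̂ᵗ Γ(1+t) n^{−t}]` as a Mellin
# transform, and its decay on vertical lines

Source: E. Kowalski, P. Michel, J. VanderKam, J. reine angew. Math. 526 (2000), (13) p. 9 and
(21)–(22) p. 12 [held: paper:doi-10-1515-crll-2000-074]. Cell landau-siegel / ls-inputs, line H-AFE2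
(K-INPUTS-11 (1)), seat ls-inputs-Hafe-lead g1; infrastructure for stub T3 (`stub_afeW_eq_logCutoffW`)
of the fact skeleton `log-fricke-split`. Proofs only (no definitions, no named facts).

Write `c = q̂/n > 0` and `φ_c(u) = (u/c) e^{−u/c}` on `(0, ∞)`. Then (Euler's integral, `u = cx`)
`q̂ˢ Γ(1+s) n^{−s} = cˢ Γ(1+s) = 𝓜φ_c(s)` for `Re s > −1` (`KMV2000.afeKernel_base_eq_mellin`), so by
iterated differentiation under the Mellin integral on the half-plane `Re s > −1`
(`Literature.Analysis.SpecialFunctions.iteratedDeriv_mellin_eq_of_isBigO_rpow_of_lt`):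

* `KMV2000.afeKernel_eq_mellin` — `D_i(q̂;n,t) = 𝓜[(log u)^i φ_c(u)](t)` for `Re t > −1`;
* `KMV2000.afeKernel_eq_cpow_mul_integral` — `D_i(q̂;n,t) = cᵗ ∫_0^∞ xᵗ e^{−x} (log c + log x)^i dx`
  (the substitution `u = cx`), the form matching the real weight `KMV2000.logCutoffW`;
* `KMV2000.exists_norm_iteratedDeriv_mellin_kernel_le` — the trivial bound `‖D_i(q̂;n,σ+iy)‖ ≤ B(σ)`;
* `KMV2000.iteratedDeriv_mellin_kernel_add_one` — the `i`-fold differentiated functional equation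
  `g(s+1) = c(s+1)g(s)` of `g = 𝓜φ_c`: `g^{(i)}(s+1) = c((s+1)g^{(i)}(s) + i g^{(i−1)}(s))`;
* `KMV2000.exists_norm_afeKernel_le_div` — the decay `‖D_i(q̂;n,σ+iy)‖ ≤ C/‖σ+1+iy‖` on every line
  `Re t = σ > −1`, and `KMV2000.continuous_afeKernel_vertical`, `KMV2000.integrable_afeKernel_div_vertical`
  — `D_i(q̂;n,t)/t` is integrable along `Re t = σ > 0` (the vertical integrability behind the Mellin
  inversion of the weight `KMV2000.afeW`).

No Stirling formula and no contour shift are used. No claim about Landau–Siegel zeros.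
-/

noncomputable section

open scoped Real
open Complex Set MeasureTheory Filter Asymptotics
open _root_.Topology

namespace Literature.NumberTheory.LFunctions.KMV2000

/-! ### The kernel `φ_c(u) = (u/c) e^{−u/c}` and its Mellin transform `cˢ Γ(1+s)` -/

/-- **Euler's integral, scaled**: for `c > 0` and `Re s > −1`,
`cˢ Γ(1+s) = ∫_0^∞ u^{s−1} (u/c) e^{−u/c} du = 𝓜φ_c(s)`. [cite: KowalskiMichelVanderKam2000, (13) p. 9] -/
theorem cpow_mul_Gamma_eq_mellin {c : ℝ} (hc : 0 < c) {s : ℂ} (hs : -1 < s.re) :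
    (c : ℂ) ^ s * Complex.Gamma (1 + s) =
      mellin (fun u : ℝ ↦ ((u / c * Real.exp (-(u / c)) : ℝ) : ℂ)) s := by
  set Φ : ℝ → ℂ := fun x : ℝ ↦ (x : ℂ) ^ (1 : ℂ) • ((Real.exp (-x) : ℝ) : ℂ) with hΦ_def
  have hΦ : (fun u : ℝ ↦ ((u / c * Real.exp (-(u / c)) : ℝ) : ℂ)) = fun u : ℝ ↦ Φ (c⁻¹ * u) := by
    funext u
    simp only [hΦ_def, cpow_one, smul_eq_mul, div_eq_inv_mul]
    push_cast
    ring
  have hM : mellin Φ s = Complex.Gamma (1 + s) := by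
    rw [hΦ_def, mellin_cpow_smul, ← Complex.GammaIntegral_eq_mellin,
      ← Complex.Gamma_eq_integral (by simp; linarith), add_comm]
  -- `(c⁻¹)^{−s} = cˢ` (the tree's `MellinBarnes.inv_ofReal_cpow_neg`, inlined to keep imports light)
  have hinv : ((c⁻¹ : ℝ) : ℂ) ^ (-s) = (c : ℂ) ^ s := by
    have harg : (c : ℂ).arg ≠ Real.pi := by
      rw [Complex.arg_ofReal_of_nonneg hc.le]; exact Real.pi_pos.ne
    rw [Complex.ofReal_inv, Complex.cpow_neg, Complex.inv_cpow _ _ harg, inv_inv]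
  rw [hΦ, mellin_comp_mul_left Φ s (inv_pos.mpr hc), hinv, smul_eq_mul, hM]

/-- Positive real bases: `q̂ˢ n^{−s} = (q̂/n)ˢ`. [cite: KowalskiMichelVanderKam2000, (13) p. 9] -/
theorem cpow_mul_natCast_cpow_neg {qh : ℝ} (hqh : 0 < qh) {n : ℕ} (hn : n ≠ 0) (s : ℂ) :
    (qh : ℂ) ^ s * (n : ℂ) ^ (-s) = ((qh / n : ℝ) : ℂ) ^ s := by
  have hn' : (0 : ℝ) < n := by exact_mod_cast Nat.pos_of_ne_zero hn
  have h1 : (qh : ℂ) ^ s = Complex.exp ((Real.log qh : ℂ) * s) := by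
    rw [Complex.cpow_def_of_ne_zero (ofReal_ne_zero.mpr hqh.ne'), Complex.ofReal_log hqh.le]
  have h2 : (n : ℂ) ^ (-s) = Complex.exp (-(Real.log n : ℂ) * s) := by
    rw [Complex.cpow_def_of_ne_zero (Nat.cast_ne_zero.mpr hn), ← Complex.ofReal_natCast,
      Complex.ofReal_log hn'.le]
    ring_nf
  have h3 : ((qh / n : ℝ) : ℂ) ^ s = Complex.exp ((Real.log (qh / n) : ℂ) * s) := by
    rw [Complex.cpow_def_of_ne_zero (ofReal_ne_zero.mpr (div_pos hqh hn').ne'),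
      Complex.ofReal_log (div_pos hqh hn').le]
  rw [h1, h2, h3, ← Complex.exp_add, Real.log_div hqh.ne' hn'.ne']
  push_cast
  ring_nf

/-- **The base kernel is a Mellin transform**: `q̂ˢ Γ(1+s) n^{−s} = 𝓜φ_{q̂/n}(s)` for `Re s > −1`.
[cite: KowalskiMichelVanderKam2000, (13) p. 9] -/
theorem afeKernel_base_eq_mellin {qh : ℝ} (hqh : 0 < qh) {n : ℕ} (hn : n ≠ 0) {s : ℂ} (hs : -1 < s.re) :
    (qh : ℂ) ^ s * Complex.Gamma (1 + s) * (n : ℂ) ^ (-s) =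
      mellin (fun u : ℝ ↦ ((u / (qh / n) * Real.exp (-(u / (qh / n))) : ℝ) : ℂ)) s := by
  have hc : 0 < qh / n := div_pos hqh (by exact_mod_cast Nat.pos_of_ne_zero hn)
  rw [mul_right_comm, cpow_mul_natCast_cpow_neg hqh hn, cpow_mul_Gamma_eq_mellin hc hs]

/-! ### Decay hypotheses of the half-plane Mellin lemma for `φ_c` -/

/-- `φ_c` is continuous, hence locally integrable on `(0,∞)`. [cite: KowalskiMichelVanderKam2000, (13) p. 9] -/
theorem locallyIntegrableOn_kernel (c : ℝ) :
    LocallyIntegrableOn (fun u : ℝ ↦ ((u / c * Real.exp (-(u / c)) : ℝ) : ℂ)) (Ioi 0) :=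
  (Continuous.continuousOn (by fun_prop)).locallyIntegrableOn measurableSet_Ioi

/-- `φ_c` decays to every order at `+∞` (`e^{−u/c} = o(u^{r−1})`). [cite: KowalskiMichelVanderKam2000, (13) p. 9] -/
theorem isBigO_kernel_atTop {c : ℝ} (hc : 0 < c) (r : ℝ) :
    (fun u : ℝ ↦ ((u / c * Real.exp (-(u / c)) : ℝ) : ℂ)) =O[atTop] (· ^ r) := by
  have h1 : (fun u : ℝ ↦ Real.exp (-(u / c))) =O[atTop] fun u ↦ u ^ (r - 1) := by
    have := (isLittleO_exp_neg_mul_rpow_atTop (inv_pos.mpr hc) (r - 1)).isBigO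
    refine this.congr_left fun u ↦ ?_
    rw [div_eq_inv_mul, neg_mul]
  have h2 : (fun u : ℝ ↦ u / c) =O[atTop] fun u ↦ u ^ (1 : ℝ) := by
    refine IsBigO.of_bound c⁻¹ ?_
    filter_upwards [eventually_gt_atTop 0] with u hu
    rw [Real.rpow_one, Real.norm_of_nonneg (div_nonneg hu.le hc.le), Real.norm_of_nonneg hu.le,
      div_eq_inv_mul]
  have h3 := h2.mul h1
  refine Complex.isBigO_ofReal_left.mpr (h3.trans ?_)
  refine IsBigO.of_bound 1 ?_
  filter_upwards [eventually_gt_atTop 0] with u hu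
  rw [← Real.rpow_add hu, show (1 : ℝ) + (r - 1) = r by ring, one_mul]

/-- `φ_c = O(u) = O(u^{−b})` at `0⁺` for every `b ≥ −1` (`e^{−u/c} ≤ 1`, `u ≤ u^{−b}` on `(0,1]`).
[cite: KowalskiMichelVanderKam2000, (13) p. 9] -/
theorem isBigO_kernel_nhdsGT_zero {c : ℝ} (hc : 0 < c) (b : ℝ) (hb : -1 < b) :
    (fun u : ℝ ↦ ((u / c * Real.exp (-(u / c)) : ℝ) : ℂ)) =O[𝓝[>] 0] (· ^ (-b)) := by
  refine IsBigO.of_bound c⁻¹ ?_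
  have hmem : Ioo (0 : ℝ) 1 ∈ 𝓝[>] (0 : ℝ) := Ioo_mem_nhdsGT zero_lt_one
  filter_upwards [hmem] with u hu
  have hu0 : 0 < u := hu.1
  have hexp : Real.exp (-(u / c)) ≤ 1 := Real.exp_le_one_iff.mpr (by
    have := div_nonneg hu0.le hc.le; linarith)
  have hpow : u ≤ u ^ (-b) := by
    calc u = u ^ (1 : ℝ) := (Real.rpow_one u).symm
      _ ≤ u ^ (-b) := Real.rpow_le_rpow_of_exponent_ge hu0 hu.2.le (by linarith)
  rw [Complex.norm_real, Real.norm_of_nonneg (by positivity),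
    Real.norm_of_nonneg (Real.rpow_nonneg hu0.le _)]
  calc u / c * Real.exp (-(u / c)) ≤ u / c * 1 := by gcongr
    _ = c⁻¹ * u := by ring
    _ ≤ c⁻¹ * u ^ (-b) := by gcongr

/-! ### `D_i` as a Mellin transform -/

/-- **The derivative kernel is a Mellin transform**: for `q̂ > 0`, `n ≥ 1`, `Re t > −1`,
`D_i(q̂; n, t) = ∂ᵢ/∂tⁱ[q̂ᵗΓ(1+t)n^{−t}] = ∫_0^∞ u^{t−1} (log u)^i (u/c) e^{−u/c} du`, `c = q̂/n`
(differentiation under Euler's integral). [cite: KowalskiMichelVanderKam2000, (13) p. 9 and (22) p. 12] -/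
theorem afeKernel_eq_mellin {qh : ℝ} (hqh : 0 < qh) {n : ℕ} (hn : n ≠ 0) (i : ℕ) {t : ℂ} (ht : -1 < t.re) :
    afeKernel qh i n t =
      mellin (fun u : ℝ ↦ ((Real.log u) ^ i : ℝ) •
        (((u / (qh / n) * Real.exp (-(u / (qh / n))) : ℝ) : ℂ))) t := by
  have hc : 0 < qh / n := div_pos hqh (by exact_mod_cast Nat.pos_of_ne_zero hn)
  have hopen : IsOpen {s : ℂ | -1 < s.re} := isOpen_lt continuous_const Complex.continuous_re
  have heq : Set.EqOn (fun s : ℂ ↦ ((qh : ℂ) ^ s) * Complex.Gamma (1 + s) * ((n : ℂ) ^ (-s)))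
      (mellin (fun u : ℝ ↦ ((u / (qh / n) * Real.exp (-(u / (qh / n))) : ℝ) : ℂ)))
      {s : ℂ | -1 < s.re} := fun s hs ↦ afeKernel_base_eq_mellin hqh hn hs
  rw [afeKernel, heq.iteratedDeriv_of_isOpen hopen i ht]
  exact Literature.Analysis.SpecialFunctions.iteratedDeriv_mellin_eq_of_isBigO_rpow_of_lt
    (locallyIntegrableOn_kernel _) (isBigO_kernel_atTop hc) (fun b hb ↦ isBigO_kernel_nhdsGT_zero hc b hb)
    i ht

/-- **The derivative kernel in the real-weight form**: for `q̂ > 0`, `n ≥ 1`, `Re t > −1`, `c = q̂/n`,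
`D_i(q̂; n, t) = cᵗ ∫_0^∞ xᵗ e^{−x} (log c + log x)^i dx` (substitute `u = cx` in `afeKernel_eq_mellin`).
[cite: KowalskiMichelVanderKam2000, (13) p. 9 and (21)–(22) p. 12] -/
theorem afeKernel_eq_cpow_mul_integral {qh : ℝ} (hqh : 0 < qh) {n : ℕ} (hn : n ≠ 0) (i : ℕ) {t : ℂ}
    (ht : -1 < t.re) :
    afeKernel qh i n t =
      ((qh / n : ℝ) : ℂ) ^ t * ∫ x in Ioi (0 : ℝ), (x : ℂ) ^ t *
        ((Real.exp (-x) * (Real.log (qh / n) + Real.log x) ^ i : ℝ) : ℂ) := by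
  set c : ℝ := qh / n with hc_def
  have hc : 0 < c := div_pos hqh (by exact_mod_cast Nat.pos_of_ne_zero hn)
  rw [afeKernel_eq_mellin hqh hn i ht, mellin]
  -- substitute `u = c x`
  have hsub := integral_comp_mul_left_Ioi
    (fun u : ℝ ↦ (u : ℂ) ^ (t - 1) • (((Real.log u) ^ i : ℝ) • (((u / c * Real.exp (-(u / c))) : ℝ) : ℂ)))
    0 hc
  rw [mul_zero] at hsub
  have hc' : (c : ℂ) ≠ 0 := ofReal_ne_zero.mpr hc.ne'
  -- `∫ G(u) du = c • ∫ G(cx) dx`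
  have hI : ∫ u in Ioi (0 : ℝ), (u : ℂ) ^ (t - 1) • (((Real.log u) ^ i : ℝ) •
        (((u / c * Real.exp (-(u / c))) : ℝ) : ℂ)) =
      (c : ℂ) * ∫ x in Ioi (0 : ℝ), ((c * x : ℝ) : ℂ) ^ (t - 1) • (((Real.log (c * x)) ^ i : ℝ) •
        ((((c * x) / c * Real.exp (-((c * x) / c))) : ℝ) : ℂ)) := by
    rw [hsub, ← Complex.coe_smul, Complex.ofReal_inv, smul_eq_mul, ← mul_assoc,
      mul_inv_cancel₀ hc', one_mul]
  rw [hI, ← integral_const_mul, ← integral_const_mul]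
  refine setIntegral_congr_fun measurableSet_Ioi fun x hx ↦ ?_
  have hx : (0 : ℝ) < x := hx
  have hcx : c * x / c = x := by field_simp
  rw [hcx, Real.log_mul hc.ne' hx.ne', Complex.ofReal_mul,
    Complex.mul_cpow_ofReal_nonneg hc.le hx.le, Complex.real_smul, smul_eq_mul]
  have hxc : (x : ℂ) ^ (t - 1) * (x : ℂ) = (x : ℂ) ^ t := by
    conv_rhs => rw [show t = (t - 1) + 1 by ring]
    rw [Complex.cpow_add _ _ (ofReal_ne_zero.mpr hx.ne'), cpow_one]
  have hct : (c : ℂ) * (c : ℂ) ^ (t - 1) = (c : ℂ) ^ t := by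
    conv_rhs => rw [show t = 1 + (t - 1) by ring]
    rw [Complex.cpow_add _ _ hc', cpow_one]
  push_cast
  rw [← hct, ← hxc]
  ring

/-! ### Uniform bounds on vertical lines -/

/-- The `log`-weighted kernel converges absolutely in the Mellin sense on `Re s > −1`.
[cite: KowalskiMichelVanderKam2000, (13) p. 9] -/
theorem mellinConvergent_log_pow_kernel {c : ℝ} (hc : 0 < c) (i : ℕ) {s : ℂ} (hs : -1 < s.re) :
    MellinConvergent (fun u : ℝ ↦ ((Real.log u) ^ i : ℝ) •
      (((u / c * Real.exp (-(u / c))) : ℝ) : ℂ)) s :=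
  Literature.Analysis.SpecialFunctions.mellinConvergent_log_pow_smul_of_isBigO_rpow_of_lt
    (locallyIntegrableOn_kernel _) (isBigO_kernel_atTop hc) (fun b hb ↦ isBigO_kernel_nhdsGT_zero hc b hb)
    i hs

/-- The trivial vertical bound for a Mellin transform: `‖𝓜ψ(s)‖ ≤ ∫_0^∞ u^{Re s − 1} ‖ψ(u)‖ du`.
[cite: KowalskiMichelVanderKam2000, (22) p. 12] -/
theorem norm_mellin_le_integral (ψ : ℝ → ℂ) (s : ℂ) :
    ‖mellin ψ s‖ ≤ ∫ u in Ioi (0 : ℝ), u ^ (s.re - 1) * ‖ψ u‖ := by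
  rw [mellin]
  refine (norm_integral_le_integral_norm _).trans (le_of_eq ?_)
  refine setIntegral_congr_fun measurableSet_Ioi fun u hu ↦ ?_
  rw [norm_smul, Complex.norm_cpow_eq_rpow_re_of_pos hu, sub_re, one_re]

/-- **Trivial bound, uniform on the line**: for `σ > −1` there is `B` with `‖D_i(q̂;n,σ+iy)‖ ≤ B` for all
`y` (namely `B = ∫_0^∞ u^{σ−1}|log u|^i φ_c(u) du`). [cite: KowalskiMichelVanderKam2000, (13) p. 9] -/
theorem exists_norm_iteratedDeriv_mellin_kernel_le {c : ℝ} (hc : 0 < c) (i : ℕ) {σ : ℝ} (hσ : -1 < σ) :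
    ∃ B : ℝ, 0 ≤ B ∧ ∀ s : ℂ, s.re = σ →
      ‖iteratedDeriv i (mellin (fun u : ℝ ↦ ((u / c * Real.exp (-(u / c)) : ℝ) : ℂ))) s‖ ≤ B := by
  set ψ : ℝ → ℂ := fun u : ℝ ↦ ((Real.log u) ^ i : ℝ) •
    (((u / c * Real.exp (-(u / c))) : ℝ) : ℂ) with hψ
  refine ⟨∫ u in Ioi (0 : ℝ), u ^ (σ - 1) * ‖ψ u‖, ?_, fun s hs ↦ ?_⟩
  · exact setIntegral_nonneg measurableSet_Ioi fun u hu ↦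
      mul_nonneg (Real.rpow_nonneg (le_of_lt hu) _) (norm_nonneg _)
  · have hs' : -1 < s.re := by rw [hs]; exact hσ
    rw [Literature.Analysis.SpecialFunctions.iteratedDeriv_mellin_eq_of_isBigO_rpow_of_lt
      (locallyIntegrableOn_kernel _) (isBigO_kernel_atTop hc) (fun b hb ↦ isBigO_kernel_nhdsGT_zero hc b hb)
      i hs']
    have h := norm_mellin_le_integral ψ s
    rw [hs] at h
    exact h

/-! ### The differentiated functional equation and the `1/|t|` decay -/

/-- The functional equation of `g = 𝓜φ_c = cˢΓ(1+s)`: `g(s+1) = c (s+1) g(s)` for `Re s > −1`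
(`Γ(s+2) = (s+1)Γ(s+1)`). [cite: KowalskiMichelVanderKam2000, (13) p. 9] -/
theorem mellin_kernel_add_one {c : ℝ} (hc : 0 < c) {s : ℂ} (hs : -1 < s.re) :
    mellin (fun u : ℝ ↦ ((u / c * Real.exp (-(u / c)) : ℝ) : ℂ)) (s + 1) =
      (c : ℂ) * (s + 1) * mellin (fun u : ℝ ↦ ((u / c * Real.exp (-(u / c)) : ℝ) : ℂ)) s := by
  have hs1 : -1 < (s + 1).re := by simp; linarith
  have hne : s + 1 ≠ 0 := by
    intro h
    have := congrArg Complex.re h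
    simp at this
    linarith
  rw [← cpow_mul_Gamma_eq_mellin hc hs, ← cpow_mul_Gamma_eq_mellin hc hs1,
    show (1 : ℂ) + (s + 1) = (1 + s) + 1 by ring, Complex.Gamma_add_one _ (by rwa [add_comm]),
    Complex.cpow_add _ _ (ofReal_ne_zero.mpr hc.ne'), cpow_one]
  ring

/-- `g = 𝓜φ_c` is analytic on the open half-plane `Re s > −1`. [cite: KowalskiMichelVanderKam2000, (13) p. 9] -/
theorem analyticOnNhd_mellin_kernel {c : ℝ} (hc : 0 < c) :
    AnalyticOnNhd ℂ (mellin (fun u : ℝ ↦ ((u / c * Real.exp (-(u / c)) : ℝ) : ℂ))) {s : ℂ | -1 < s.re} :=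
  (Literature.Analysis.SpecialFunctions.differentiableOn_mellin_of_isBigO_rpow_of_lt
    (locallyIntegrableOn_kernel _) (isBigO_kernel_atTop hc)
    (fun b hb ↦ isBigO_kernel_nhdsGT_zero hc b hb)).analyticOnNhd
    (isOpen_lt continuous_const Complex.continuous_re)

/-- Every iterated derivative of `g = 𝓜φ_c` is analytic on `Re s > −1`. [cite: KowalskiMichelVanderKam2000, (13) p. 9] -/
theorem analyticOnNhd_iteratedDeriv_mellin_kernel {c : ℝ} (hc : 0 < c) (i : ℕ) :
    AnalyticOnNhd ℂ (iteratedDeriv i (mellin (fun u : ℝ ↦ ((u / c * Real.exp (-(u / c)) : ℝ) : ℂ))))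
      {s : ℂ | -1 < s.re} := by
  rw [iteratedDeriv_eq_iterate]
  exact (analyticOnNhd_mellin_kernel hc).iterated_deriv i

/-- **The `i`-fold differentiated functional equation**: for `g = 𝓜φ_c` and `Re s > −1`,
`g^{(i)}(s+1) = c · ((s+1) g^{(i)}(s) + i · g^{(i−1)}(s))` (differentiate `g(s+1) = c(s+1)g(s)` `i` times;
the term `i · g^{(i−1)}` is `0` for `i = 0`). [cite: KowalskiMichelVanderKam2000, (13) p. 9 and (22) p. 12] -/
theorem iteratedDeriv_mellin_kernel_add_one {c : ℝ} (hc : 0 < c) (i : ℕ) {s : ℂ} (hs : -1 < s.re) :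
    iteratedDeriv i (mellin (fun u : ℝ ↦ ((u / c * Real.exp (-(u / c)) : ℝ) : ℂ))) (s + 1) =
      (c : ℂ) * ((s + 1) * iteratedDeriv i (mellin (fun u : ℝ ↦ ((u / c * Real.exp (-(u / c)) : ℝ) : ℂ))) s
        + (i : ℂ) * iteratedDeriv (i - 1) (mellin (fun u : ℝ ↦ ((u / c * Real.exp (-(u / c)) : ℝ) : ℂ))) s) := by
  set g : ℂ → ℂ := mellin (fun u : ℝ ↦ ((u / c * Real.exp (-(u / c)) : ℝ) : ℂ)) with hg
  have hopen : IsOpen {z : ℂ | -1 < z.re} := isOpen_lt continuous_const Complex.continuous_re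
  induction i generalizing s with
  | zero =>
    simp only [iteratedDeriv_zero, Nat.cast_zero, zero_mul, add_zero]
    rw [hg, mellin_kernel_add_one hc hs]
    ring
  | succ i ih =>
    -- differentiate the order-`i` identity, valid on the open half-plane, at `s`
    have hD : ∀ m : ℕ, ∀ z : ℂ, -1 < z.re → DifferentiableAt ℂ (iteratedDeriv m g) z := fun m z hz ↦
      ((analyticOnNhd_iteratedDeriv_mellin_kernel hc m) z hz).differentiableAt
    have hev : (fun z : ℂ ↦ iteratedDeriv i g (z + 1)) =ᶠ[𝓝 s]
        fun z : ℂ ↦ (c : ℂ) * ((z + 1) * iteratedDeriv i g z + (i : ℂ) * iteratedDeriv (i - 1) g z) := by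
      filter_upwards [hopen.mem_nhds hs] with z hz
      exact ih hz
    have hderiv := hev.deriv_eq
    -- left side
    have hL : deriv (fun z : ℂ ↦ iteratedDeriv i g (z + 1)) s = iteratedDeriv (i + 1) g (s + 1) := by
      rw [deriv_comp_add_const, iteratedDeriv_succ]
    -- right side
    have hs1 : -1 < (s + 1).re := by simp; linarith
    have hd_i : DifferentiableAt ℂ (iteratedDeriv i g) s := hD i s hs
    have hd_im : DifferentiableAt ℂ (iteratedDeriv (i - 1) g) s := hD (i - 1) s hs
    have hR : deriv (fun z : ℂ ↦ (c : ℂ) * ((z + 1) * iteratedDeriv i g z +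
        (i : ℂ) * iteratedDeriv (i - 1) g z)) s =
        (c : ℂ) * ((s + 1) * iteratedDeriv (i + 1) g s + ((i : ℂ) + 1) * iteratedDeriv i g s) := by
      have h1 : HasDerivAt (fun z : ℂ ↦ z + 1) 1 s := (hasDerivAt_id s).add_const 1
      have h2 : HasDerivAt (iteratedDeriv i g) (iteratedDeriv (i + 1) g s) s := by
        rw [iteratedDeriv_succ]; exact hd_i.hasDerivAt
      have h3 : HasDerivAt (iteratedDeriv (i - 1) g) (deriv (iteratedDeriv (i - 1) g) s) s :=
        hd_im.hasDerivAt
      have h4 : HasDerivAt (fun z : ℂ ↦ (c : ℂ) * ((z + 1) * iteratedDeriv i g z +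
          (i : ℂ) * iteratedDeriv (i - 1) g z))
          ((c : ℂ) * (1 * iteratedDeriv i g s + (s + 1) * iteratedDeriv (i + 1) g s +
            (i : ℂ) * deriv (iteratedDeriv (i - 1) g) s)) s :=
        ((h1.mul h2).add (h3.const_mul (i : ℂ))).const_mul (c : ℂ)
      rw [h4.deriv]
      rcases Nat.eq_zero_or_pos i with hi | hi
      · subst hi
        simp only [Nat.cast_zero, zero_mul, add_zero, zero_add]
        ring
      · have him : iteratedDeriv (i - 1 + 1) g = iteratedDeriv i g := by
          rw [Nat.sub_add_cancel hi]
        rw [← iteratedDeriv_succ, him]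
        ring
    rw [hL, hR] at hderiv
    rw [hderiv, Nat.add_sub_cancel]
    push_cast
    ring

/-- **Decay on vertical lines**: for `q̂ > 0`, `n ≥ 1`, `σ > −1` there is `C` such that
`‖D_i(q̂; n, σ+iy)‖ ≤ C / ‖σ + 1 + iy‖` for all real `y` (from the differentiated functional equation:
`(t+1) D_i(t) = D_i(t+1)/c − i D_{i−1}(t)` and the trivial bounds on the lines `Re t = σ, σ+1`).
[cite: KowalskiMichelVanderKam2000, (22) p. 12 («decays faster than any negative power»)] -/
theorem exists_norm_afeKernel_le_div {qh : ℝ} (hqh : 0 < qh) {n : ℕ} (hn : n ≠ 0) (i : ℕ) {σ : ℝ}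
    (hσ : -1 < σ) :
    ∃ C : ℝ, 0 ≤ C ∧ ∀ y : ℝ, ‖afeKernel qh i n (σ + y * I)‖ ≤ C / ‖(σ : ℂ) + 1 + y * I‖ := by
  set c : ℝ := qh / n with hc_def
  have hc : 0 < c := div_pos hqh (by exact_mod_cast Nat.pos_of_ne_zero hn)
  set g : ℂ → ℂ := mellin (fun u : ℝ ↦ ((u / c * Real.exp (-(u / c)) : ℝ) : ℂ)) with hg
  obtain ⟨B₁, hB₁, h₁⟩ := exists_norm_iteratedDeriv_mellin_kernel_le hc i (σ := σ + 1) (by linarith)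
  obtain ⟨B₀, hB₀, h₀⟩ := exists_norm_iteratedDeriv_mellin_kernel_le hc (i - 1) hσ
  refine ⟨B₁ / c + i * B₀, by positivity, fun y ↦ ?_⟩
  set t : ℂ := (σ : ℂ) + y * I with ht_def
  have ht : -1 < t.re := by simp [ht_def]; exact hσ
  have hne : t + 1 ≠ 0 := by
    intro h; have := congrArg Complex.re h; simp [ht_def] at this; linarith
  have hnorm : 0 < ‖t + 1‖ := norm_pos_iff.mpr hne
  -- `afeKernel = g^{(i)}` on the half-plane
  have hopen : IsOpen {s : ℂ | -1 < s.re} := isOpen_lt continuous_const Complex.continuous_re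
  have heq : Set.EqOn (fun s : ℂ ↦ ((qh : ℂ) ^ s) * Complex.Gamma (1 + s) * ((n : ℂ) ^ (-s))) g
      {s : ℂ | -1 < s.re} := fun s hs ↦ afeKernel_base_eq_mellin hqh hn hs
  have hK : afeKernel qh i n t = iteratedDeriv i g t := by
    rw [afeKernel, heq.iteratedDeriv_of_isOpen hopen i ht]
  -- the recursion solved for `g^{(i)}(t)`
  have hrec : iteratedDeriv i g (t + 1) =
      (c : ℂ) * ((t + 1) * iteratedDeriv i g t + (i : ℂ) * iteratedDeriv (i - 1) g t) :=
    iteratedDeriv_mellin_kernel_add_one hc i ht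
  have hsolve : iteratedDeriv i g t =
      (iteratedDeriv i g (t + 1) / c - (i : ℂ) * iteratedDeriv (i - 1) g t) / (t + 1) := by
    have hc' : (c : ℂ) ≠ 0 := ofReal_ne_zero.mpr hc.ne'
    rw [hrec, eq_div_iff hne]
    field_simp
    ring
  have hb1 : ‖iteratedDeriv i g (t + 1)‖ ≤ B₁ := h₁ (t + 1) (by simp [ht_def])
  have hb0 : ‖iteratedDeriv (i - 1) g t‖ ≤ B₀ := h₀ t (by simp [ht_def])
  have htt : (σ : ℂ) + 1 + y * I = t + 1 := by rw [ht_def]; ring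
  rw [hK, hsolve, htt, norm_div, div_le_div_iff_of_pos_right hnorm]
  calc ‖iteratedDeriv i g (t + 1) / c - (i : ℂ) * iteratedDeriv (i - 1) g t‖
      ≤ ‖iteratedDeriv i g (t + 1) / c‖ + ‖(i : ℂ) * iteratedDeriv (i - 1) g t‖ := norm_sub_le _ _
    _ = ‖iteratedDeriv i g (t + 1)‖ / c + i * ‖iteratedDeriv (i - 1) g t‖ := by
        rw [norm_div, norm_mul, Complex.norm_real, Real.norm_of_nonneg hc.le, Complex.norm_natCast]
    _ ≤ B₁ / c + i * B₀ := by gcongr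

/-- `y ↦ D_i(q̂; n, σ+iy)` is continuous for `σ > −1` (`D_i` is analytic there).
[cite: KowalskiMichelVanderKam2000, (22) p. 12] -/
theorem continuous_afeKernel_vertical {qh : ℝ} (hqh : 0 < qh) {n : ℕ} (hn : n ≠ 0) (i : ℕ) {σ : ℝ}
    (hσ : -1 < σ) :
    Continuous fun y : ℝ ↦ afeKernel qh i n (σ + y * I) := by
  set c : ℝ := qh / n with hc_def
  have hc : 0 < c := div_pos hqh (by exact_mod_cast Nat.pos_of_ne_zero hn)
  set g : ℂ → ℂ := mellin (fun u : ℝ ↦ ((u / c * Real.exp (-(u / c)) : ℝ) : ℂ)) with hg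
  have hopen : IsOpen {s : ℂ | -1 < s.re} := isOpen_lt continuous_const Complex.continuous_re
  have heq : Set.EqOn (fun s : ℂ ↦ ((qh : ℂ) ^ s) * Complex.Gamma (1 + s) * ((n : ℂ) ^ (-s))) g
      {s : ℂ | -1 < s.re} := fun s hs ↦ afeKernel_base_eq_mellin hqh hn hs
  have hK : (fun y : ℝ ↦ afeKernel qh i n (σ + y * I)) = fun y : ℝ ↦ iteratedDeriv i g (σ + y * I) := by
    funext y
    have hy : -1 < ((σ : ℂ) + y * I).re := by simp; exact hσ
    rw [afeKernel, heq.iteratedDeriv_of_isOpen hopen i hy]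
  rw [hK]
  have hcont : ContinuousOn (iteratedDeriv i g) {s : ℂ | -1 < s.re} :=
    (analyticOnNhd_iteratedDeriv_mellin_kernel hc i).continuousOn
  have hline : Continuous fun y : ℝ ↦ (σ : ℂ) + y * I := by fun_prop
  exact hcont.comp_continuous hline fun y ↦ by simp; exact hσ

/-- **`D_i(q̂; n, t)/t` is integrable along every line `Re t = σ > 0`** (`‖·‖ ≤ C/(m(1+y²))`,
`m = min σ 1`): the vertical integrability behind the Mellin inversion of the AFE weight.
[cite: KowalskiMichelVanderKam2000, (22) p. 12] -/
theorem integrable_afeKernel_div_vertical {qh : ℝ} (hqh : 0 < qh) {n : ℕ} (hn : n ≠ 0) (i : ℕ)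
    {σ : ℝ} (hσ : 0 < σ) :
    Integrable fun y : ℝ ↦ afeKernel qh i n (σ + y * I) / (σ + y * I) := by
  obtain ⟨C, hC, h⟩ := exists_norm_afeKernel_le_div hqh hn i (σ := σ) (by linarith)
  have hcont : Continuous fun y : ℝ ↦ afeKernel qh i n (σ + y * I) / (σ + y * I) := by
    refine (continuous_afeKernel_vertical hqh hn i (by linarith)).div (by fun_prop) fun y h ↦ ?_
    have := congrArg Complex.re h
    simp at this
    linarith
  set m : ℝ := min σ 1 with hm_def
  have hm : 0 < m := lt_min hσ one_pos
  refine Integrable.mono' (integrable_inv_one_add_sq.const_mul (C / m))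
    hcont.aestronglyMeasurable (ae_of_all _ fun y ↦ ?_)
  set w : ℝ := ‖(σ : ℂ) + 1 + y * I‖ with hw_def
  set v : ℝ := ‖(σ : ℂ) + y * I‖ with hv_def
  have hw2 : w ^ 2 = (σ + 1) ^ 2 + y ^ 2 := by
    rw [hw_def, Complex.sq_norm, Complex.normSq_apply]; simp; ring
  have hv2 : v ^ 2 = σ ^ 2 + y ^ 2 := by
    rw [hv_def, Complex.sq_norm, Complex.normSq_apply]; simp; ring
  have hpos : 0 < (1 : ℝ) + y ^ 2 := by positivity
  have hmσ : m ^ 2 ≤ σ ^ 2 := pow_le_pow_left₀ hm.le (min_le_left _ _) 2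
  have hm1 : m ^ 2 ≤ 1 := by
    have h1 : m ≤ 1 := min_le_right _ _
    nlinarith
  have hA : 1 + y ^ 2 ≤ (σ + 1) ^ 2 + y ^ 2 := by nlinarith
  have hB : m ^ 2 * (1 + y ^ 2) ≤ σ ^ 2 + y ^ 2 := by nlinarith [sq_nonneg y]
  have hsq : (m * (1 + y ^ 2)) ^ 2 ≤ (w * v) ^ 2 := by
    rw [mul_pow, mul_pow, hw2, hv2]
    calc m ^ 2 * (1 + y ^ 2) ^ 2 = (1 + y ^ 2) * (m ^ 2 * (1 + y ^ 2)) := by ring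
      _ ≤ ((σ + 1) ^ 2 + y ^ 2) * (σ ^ 2 + y ^ 2) :=
          mul_le_mul hA hB (by positivity) (by positivity)
  have hwv : m * (1 + y ^ 2) ≤ w * v :=
    (pow_le_pow_iff_left₀ (by positivity) (by positivity) two_ne_zero).mp hsq
  have hden : 0 < m * (1 + y ^ 2) := by positivity
  rw [norm_div]
  calc ‖afeKernel qh i n (σ + y * I)‖ / v ≤ (C / w) / v :=
        div_le_div_of_nonneg_right (h y) (norm_nonneg _)
    _ = C / (w * v) := by rw [div_div]
    _ ≤ C / (m * (1 + y ^ 2)) := div_le_div_of_nonneg_left hC hden hwv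
    _ = C / m * (1 + y ^ 2)⁻¹ := by rw [div_mul_eq_div_div, div_eq_mul_inv]

end Literature.NumberTheory.LFunctions.KMV2000

end
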